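import Literature.Probability.LatticeModels.DomainDiscretisation
import Literature.Topology.PlaneTopology.UniformLocalConnectedness

/-!
# Shadowing a Jordan loop by a closed lattice walk

Support file for `RectilinearSuffices` (route CardyBoundaryCoulombGas of `CardyFormulaZ2`,
item stmt-CriticalPhenomena-5663). For a Jordan domain `D` with boundary loop `β`, a mesh `h > 0`
and a parameter step bound `L > 0`, there is a closed walk on `ℤ²` (consecutive sites equal or
nearest neighbours), each site carrying a parameter, such that the parameters increase from `0`
to more than `1/2` by steps `< L`, the walk returns to its initial site, and the site with
parameter `σ` is within `3h` of `β σ` (`exists_shadow_walk`). Construction: sample `β` at the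
`N`-th roots `k/N` (`N` large), round to the nearest site, and interpolate consecutive roundings
(which differ by at most one in each coordinate) by an intermediate site.
-/

noncomputable section

namespace Summit.CriticalPhenomena.CardyFormulaZ2.Theorems

open Set Metric Complex
open Literature.Probability.LatticeModels Literature.Probability.RandomPlanarGeometry

/-- Roundings of reals less than `1` apart differ by at most `1`. [folklore] -/
theorem abs_round_sub_round_le_one {a b : ℝ} (h : |a - b| < 1) : |round a - round b| ≤ 1 := by
  rw [round_eq, round_eq]
  have h1 := Int.floor_le (a + 1 / 2)
  have h2 := Int.lt_floor_add_one (a + 1 / 2)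
  have h3 := Int.floor_le (b + 1 / 2)
  have h4 := Int.lt_floor_add_one (b + 1 / 2)
  rw [abs_lt] at h
  rw [abs_le]
  constructor
  · have : (⌊b + 1 / 2⌋ : ℝ) < ⌊a + 1 / 2⌋ + 2 := by linarith
    have : ⌊b + 1 / 2⌋ < ⌊a + 1 / 2⌋ + 2 := by exact_mod_cast this
    omega
  · have : (⌊a + 1 / 2⌋ : ℝ) < ⌊b + 1 / 2⌋ + 2 := by linarith
    have : ⌊a + 1 / 2⌋ < ⌊b + 1 / 2⌋ + 2 := by exact_mod_cast this
    omega

/-- Nearby points round to sites differing by at most one in each coordinate. [folklore] -/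
theorem abs_nearestSite_sub_le {h : ℝ} (hh : 0 < h) {z z' : ℂ} (hzz' : dist z z' < h) (i : Fin 2) :
    |nearestSite h z i - nearestSite h z' i| ≤ 1 := by
  have key : ∀ a b : ℝ, |a - b| < h → |round (a / h) - round (b / h)| ≤ 1 := fun a b hab =>
    abs_round_sub_round_le_one (by
      rw [← sub_div, abs_div, abs_of_pos hh, div_lt_one hh]; exact hab)
  rw [Complex.dist_eq] at hzz'
  fin_cases i
  · exact key _ _ ((abs_re_le_norm (z - z')).trans_lt hzz')
  · exact key _ _ ((abs_im_le_norm (z - z')).trans_lt hzz')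

/-- Two sites agreeing in the second coordinate and differing by at most one in the first are
equal or nearest neighbours. [folklore] -/
theorem eq_or_adj_of_coord_zero {x y : Site 2} (h1 : x 1 = y 1) (h0 : |x 0 - y 0| ≤ 1) :
    x = y ∨ (zdGraph 2).Adj x y := by
  rcases abs_le.1 h0 with ⟨ha, hb⟩
  by_cases he : x 0 = y 0
  · left; ext i; fin_cases i; exacts [he, h1]
  right
  rw [zdGraph_adj_iff]
  refine ⟨0, ?_⟩
  rcases lt_or_gt_of_ne he with hlt | hlt
  · left; ext i; fin_cases i <;> simp <;> omega
  · right; ext i; fin_cases i <;> simp <;> omega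

/-- Two sites agreeing in the first coordinate and differing by at most one in the second are
equal or nearest neighbours. [folklore] -/
theorem eq_or_adj_of_coord_one {x y : Site 2} (h0 : x 0 = y 0) (h1 : |x 1 - y 1| ≤ 1) :
    x = y ∨ (zdGraph 2).Adj x y := by
  rcases abs_le.1 h1 with ⟨ha, hb⟩
  by_cases he : x 1 = y 1
  · left; ext i; fin_cases i; exacts [h0, he]
  right
  rw [zdGraph_adj_iff]
  refine ⟨1, ?_⟩
  rcases lt_or_gt_of_ne he with hlt | hlt
  · left; ext i; fin_cases i <;> simp <;> omega
  · right; ext i; fin_cases i <;> simp <;> omega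

/-- The distance of two mesh points in terms of the coordinate differences. [folklore] -/
theorem dist_meshPoint_le {h : ℝ} (hh : 0 ≤ h) (x y : Site 2) :
    dist (meshPoint h x) (meshPoint h y) ≤ h * |((x 0 : ℤ) : ℝ) - y 0| + h * |((x 1 : ℤ) : ℝ) - y 1| := by
  rw [Complex.dist_eq]
  refine (Complex.norm_le_abs_re_add_abs_im _).trans ?_
  rw [Complex.sub_re, Complex.sub_im, meshPoint_re, meshPoint_re, meshPoint_im, meshPoint_im,
    ← mul_sub, ← mul_sub, abs_mul, abs_mul, abs_of_nonneg hh]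

/-- **The shadowing closed walk.** See the module docstring. [folklore] -/
theorem exists_shadow_walk (D : JordanDomain) {h L : ℝ} (hh : 0 < h) (hL : 0 < L) :
    ∃ (n : ℕ) (F : ℕ → Site 2 × ℝ), 0 < n ∧ (F 0).2 = 0 ∧ (F n).1 = (F 0).1 ∧ 1 / 2 < (F n).2 ∧
      (∀ j, j ≤ n → 0 ≤ (F j).2 ∧ (F j).2 ≤ 1) ∧
      (∀ j, j < n → ((F j).1 = (F (j + 1)).1 ∨ (zdGraph 2).Adj (F j).1 (F (j + 1)).1) ∧
        (F j).2 < (F (j + 1)).2 ∧ (F (j + 1)).2 - (F j).2 < L) ∧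
      (∀ j, j ≤ n → dist (meshPoint h (F j).1) (D.boundary (F j).2) ≤ 3 * h) := by
  set β := D.boundary with hβ
  -- uniform continuity of `β` at scale `h`, and the sampling rate `N`
  obtain ⟨τ, hτ, -, hτh⟩ := D.exists_forall_dist_boundary_lt hh
  obtain ⟨N, hN1, hNτ, hNL⟩ : ∃ N : ℕ, 0 < N ∧ 1 / (N : ℝ) ≤ τ ∧ 1 / (N : ℝ) < L := by
    refine ⟨⌈max (1 / τ) (1 / L)⌉₊ + 1, Nat.succ_pos _, ?_, ?_⟩
    · have h1 : 1 / τ ≤ (⌈max (1 / τ) (1 / L)⌉₊ : ℝ) := (le_max_left _ _).trans (Nat.le_ceil _)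
      rw [div_le_iff₀ (by positivity)]
      push_cast
      have := (div_le_iff₀ hτ).1 h1
      nlinarith
    · have h1 : 1 / L ≤ (⌈max (1 / τ) (1 / L)⌉₊ : ℝ) := (le_max_right _ _).trans (Nat.le_ceil _)
      rw [div_lt_iff₀ (by positivity)]
      push_cast
      have := (div_le_iff₀ hL).1 h1
      nlinarith
  have hNr : (0 : ℝ) < N := by exact_mod_cast hN1
  -- the roundings of the samples and the intermediate sites
  set v : ℕ → Site 2 := fun k => nearestSite h (β ((k : ℝ) / N)) with hv
  set u : ℕ → Site 2 := fun k => ![v (k + 1) 0, v k 1] with hu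
  set site : ℕ → Site 2 := fun j => if j % 2 = 0 then v (j / 2) else u (j / 2) with hsite
  set param : ℕ → ℝ := fun j => ((j + (j - 1) / 2 : ℕ) : ℝ) / (3 * N) with hparam
  -- consecutive samples are `h`-close, so their roundings differ by `≤ 1` coordinatewise
  have hsample : ∀ k : ℕ, dist (β ((k : ℝ) / N)) (β (((k + 1 : ℕ) : ℝ) / N)) < h := fun k =>
    hτh _ _ (by
      rw [show ((k : ℝ) / N - ((k + 1 : ℕ) : ℝ) / N) = -(1 / N) by push_cast; field_simp; ring,
        abs_neg, abs_of_pos (by positivity)]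
      exact hNτ)
  have hvv : ∀ (k : ℕ) (i : Fin 2), |v k i - v (k + 1) i| ≤ 1 := fun k i =>
    abs_nearestSite_sub_le hh (hsample k) i
  -- parameters
  have hparam_mono : ∀ j, param j < param (j + 1) ∧ param (j + 1) - param j < L := by
    intro j
    have h1 : (j + (j - 1) / 2 : ℕ) < (j + 1 + (j + 1 - 1) / 2 : ℕ) := by omega
    have h2 : (j + 1 + (j + 1 - 1) / 2 : ℕ) ≤ (j + (j - 1) / 2 : ℕ) + 2 := by omega
    have h1' : ((j + (j - 1) / 2 : ℕ) : ℝ) < ((j + 1 + (j + 1 - 1) / 2 : ℕ) : ℝ) := by exact_mod_cast h1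
    have h2' : ((j + 1 + (j + 1 - 1) / 2 : ℕ) : ℝ) ≤ ((j + (j - 1) / 2 : ℕ) : ℝ) + 2 := by exact_mod_cast h2
    simp only [hparam]
    constructor
    · exact div_lt_div_of_pos_right h1' (by positivity)
    · rw [← sub_div, div_lt_iff₀ (by positivity)]
      have : 2 < L * (3 * N) := by
        have := (div_lt_iff₀ hNr).1 hNL
        nlinarith
      linarith
  have hparam_range : ∀ j, j ≤ 2 * N → 0 ≤ param j ∧ param j ≤ 1 := by
    intro j hj
    simp only [hparam]
    refine ⟨by positivity, ?_⟩
    rw [div_le_one (by positivity)]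
    have : (j + (j - 1) / 2 : ℕ) ≤ 3 * N := by omega
    exact_mod_cast this
  have hparam_near : ∀ j, |param j - ((j / 2 : ℕ) : ℝ) / N| ≤ 1 / N := by
    intro j
    simp only [hparam]
    rw [show ((j / 2 : ℕ) : ℝ) / N = (3 * (j / 2 : ℕ) : ℝ) / (3 * N) by field_simp, ← sub_div, abs_div,
      abs_of_pos (by positivity : (0 : ℝ) < 3 * N), show (1 : ℝ) / N = 3 / (3 * N) by field_simp,
      div_le_div_iff_of_pos_right (by positivity : (0 : ℝ) < 3 * N)]
    have h1 : ((j + (j - 1) / 2 : ℕ) : ℝ) - 3 * ((j / 2 : ℕ) : ℝ) ≤ 1 := by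
      have : (j + (j - 1) / 2 : ℕ) ≤ 3 * (j / 2) + 1 := by omega
      have : ((j + (j - 1) / 2 : ℕ) : ℝ) ≤ 3 * ((j / 2 : ℕ) : ℝ) + 1 := by exact_mod_cast this
      linarith
    have h2 : 3 * ((j / 2 : ℕ) : ℝ) - ((j + (j - 1) / 2 : ℕ) : ℝ) ≤ 1 := by
      have : 3 * (j / 2) ≤ (j + (j - 1) / 2 : ℕ) + 1 := by omega
      have : 3 * ((j / 2 : ℕ) : ℝ) ≤ ((j + (j - 1) / 2 : ℕ) : ℝ) + 1 := by exact_mod_cast this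
      linarith
    have := abs_sub_le_iff.2 ⟨h1, h2⟩
    linarith
  -- the shadow property
  have hround : ∀ k : ℕ, dist (meshPoint h (v k)) (β ((k : ℝ) / N)) ≤ h := fun k =>
    dist_meshPoint_nearestSite_le hh _
  have hdrift : ∀ j, dist (β (((j / 2 : ℕ) : ℝ) / N)) (β (param j)) < h := fun j =>
    hτh _ _ ((abs_sub_comm _ _).trans_le ((hparam_near j).trans hNτ))
  have hshadow : ∀ j, dist (meshPoint h (site j)) (β (param j)) ≤ 3 * h := by
    intro j
    simp only [hsite]
    split_ifs with hj
    · have := dist_triangle (meshPoint h (v (j / 2))) (β (((j / 2 : ℕ) : ℝ) / N)) (β (param j))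
      linarith [hround (j / 2), hdrift j, hh]
    · have h1 : dist (meshPoint h (u (j / 2))) (meshPoint h (v (j / 2))) ≤ h := by
        refine (dist_meshPoint_le hh.le _ _).trans ?_
        have e0 : u (j / 2) 0 = v (j / 2 + 1) 0 := by simp [hu]
        have e1 : u (j / 2) 1 = v (j / 2) 1 := by simp [hu]
        rw [e0, e1, sub_self, abs_zero, mul_zero, add_zero]
        have := hvv (j / 2) 0
        rw [abs_sub_comm] at this
        have : |((v (j / 2 + 1) 0 : ℤ) : ℝ) - v (j / 2) 0| ≤ 1 := by exact_mod_cast this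
        nlinarith
      have := dist_triangle4 (meshPoint h (u (j / 2))) (meshPoint h (v (j / 2)))
        (β (((j / 2 : ℕ) : ℝ) / N)) (β (param j))
      linarith [hround (j / 2), hdrift j]
  -- consecutive sites are equal or adjacent
  have hstep : ∀ j, site j = site (j + 1) ∨ (zdGraph 2).Adj (site j) (site (j + 1)) := by
    intro j
    simp only [hsite]
    rcases Nat.even_or_odd j with ⟨k, rfl⟩ | ⟨k, rfl⟩
    · have e1 : (k + k) % 2 = 0 := by omega
      have e2 : ¬ (k + k + 1) % 2 = 0 := by omega
      have e3 : (k + k) / 2 = k := by omega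
      have e4 : (k + k + 1) / 2 = k := by omega
      simp only [e1, e3, e4, if_true, e2, if_false]
      refine eq_or_adj_of_coord_zero (by simp [hu]) ?_
      simp only [hu, Matrix.cons_val_zero]
      exact hvv k 0
    · have e1 : ¬ (2 * k + 1) % 2 = 0 := by omega
      have e2 : (2 * k + 1 + 1) % 2 = 0 := by omega
      have e3 : (2 * k + 1) / 2 = k := by omega
      have e4 : (2 * k + 1 + 1) / 2 = k + 1 := by omega
      simp only [e1, e3, e4, if_false, e2, if_true]
      refine eq_or_adj_of_coord_one (by simp [hu]) ?_
      simp only [hu, Matrix.cons_val_one, Matrix.cons_val_fin_one]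
      exact hvv k 1
  -- the walk closes up
  have hclose : site (2 * N) = site 0 := by
    simp only [hsite, Nat.zero_mod, Nat.zero_div, if_true, show (2 * N) % 2 = 0 by omega,
      show 2 * N / 2 = N by omega]
    simp only [hv, Nat.cast_zero, zero_div, div_self hNr.ne']
    have : β 1 = β 0 := by have := D.periodic_boundary 0; rwa [zero_add] at this
    rw [this]
  have hparam0 : param 0 = 0 := by simp [hparam]
  have hparam_end : 1 / 2 < param (2 * N) := by
    simp only [hparam]
    rw [lt_div_iff₀ (by positivity)]
    have : (2 * N + (2 * N - 1) / 2 : ℕ) = 3 * N - 1 := by omega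
    rw [this]
    have h3 : 1 ≤ 3 * N := by omega
    have hN1r : (1 : ℝ) ≤ N := by exact_mod_cast hN1
    rw [Nat.cast_sub h3]
    push_cast
    linarith
  refine ⟨2 * N, fun j => (site j, param j), by omega, hparam0, hclose, hparam_end,
    fun j hj => hparam_range j hj, fun j _ => ⟨hstep j, (hparam_mono j).1, (hparam_mono j).2⟩,
    fun j _ => hshadow j⟩

end Summit.CriticalPhenomena.CardyFormulaZ2.Theorems
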